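import Literature.MathematicalPhysics.QuantumLattice.FermionConditionalFreeEnergyCertificate
import Literature.MathematicalPhysics.QuantumLattice.LiebConcavity
import HarnessLib

/-!
# The Lieb-constant conditional-entropy certificate for a window of a lattice fermion system

Topic `MathematicalPhysics/QuantumLattice`, namespace `Literature.MathematicalPhysics.QuantumLattice`.

`LiebConcavity.lean` proves the tensor-product form of the Lieb-constant certificate
(`condEntropy_le_of_liebCertificate`): on `ℋ_A ⊗ ℋ_B`, for Hermitian `G`, `G_W = V diag(u) V⋆`,
`Z⁺ ≥ Tr_A e^{−G}` and `e^c·1 − dlog_{e^{−G_W}}[Z⁺] ⪰ 0`, every density matrix satisfies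
`S(ρ) − S(Tr_A ρ) ≤ Re tr(ρG) − Re tr(Tr_Aρ · G_W) + c` (Lieb 1973 Thm 6 in supergradient form).
This file transports it through the Jordan–Wigner isomorphism to the local CAR algebra of a window
`Λ ⊆ ℤ^d` whose lexicographically LARGEST site `a` is traced out (shield `B = Λ ∖ a`, an initial segment,
so `𝔄_B ⊂ 𝔄_Λ` is a genuine tensor factor and `fermionPartialTrace` is the tensor partial trace) —
exactly as `FermionConditionalFreeEnergyCertificate.lean` does for the Lindblad / Löwner certificate:

* `fermion_condEntropy_le_of_liebCertificate_of_split` — abstract initial segment `ι : Λ₁ ↪o Λ₂` with a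
  site splitting `ε : Λ₂ ≃ A ⊕ Λ₁`;
* `fermion_condEntropy_le_of_liebCertificate` — windows of `ℤ^d`:
  `S(σ) − S(σ_{Λ∖a}) ≤ Re tr(σ G) − Re tr(σ_{Λ∖a} G_W) + c`;
* `fermion_condFreeEnergy_le_of_liebCertificate` — the same in the shape consumed by the thermal rows
  (`TorusSectorGibbsCondEntropyRow.lean`): `S(σ) − S(σ_{Λ∖a}) − Re tr(σ (G − Γ G_W)) ≤ c`.

The transport lemmas (`toSpin` of diagonal conjugations, unitaries and of the derivative map
`logFrechet`) are bookkeeping. Everything is PROVED; no definition, no named fact.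

## References

* E. H. Lieb, Adv. Math. 11 (1973) 267–288, Theorems 6–7. [Lieb1973ConvexTrace]
* D. Poulin, M. B. Hastings, Phys. Rev. Lett. 106 (2011) 080403, eqs. (4)–(8). [PoulinHastings2011]
* H. Araki, H. Moriya, Rev. Math. Phys. 15 (2003) 93–198, §4.1 (local CAR algebras). [ArakiMoriya2003]
-/

noncomputable section

namespace Literature.MathematicalPhysics.QuantumLattice

open Matrix Finset HubbardWave0 Literature.Probability.LatticeModels
open scoped ComplexOrder
open Literature.Computability.QuantumComplexity (traceLeft traceLeft_apply)
open Literature.InformationTheory.Entropy (vonNeumannEntropy vonNeumannEntropy_submatrix_equiv)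
open Literature.LinearAlgebra.Matrix (cfc_submatrix_equiv logFrechet logLoewnerMatrix)

/-! ### §1. Jordan–Wigner transport of the certificate data -/

section Transport

open JordanWigner

variable {Λ₁ : Type} [LinearOrder Λ₁] [Fintype Λ₁]

/-- `toSpin` is reindexing along `configEquiv`. [cite: EsslerEtAl2005, §12.3.4 eq. (12.196)] -/
private theorem toSpin_eq_submatrix (N : Matrix (Finset (Orb Λ₁)) (Finset (Orb Λ₁)) ℂ) :
    toSpin N = N.submatrix JordanWigner.configEquiv JordanWigner.configEquiv := by
  ext k k'; simp

/-- `toSpin (star V) = star (toSpin V)`. [cite: EsslerEtAl2005, §12.3.4 eq. (12.197)] -/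
private theorem toSpin_star (V : Matrix (Finset (Orb Λ₁)) (Finset (Orb Λ₁)) ℂ) :
    toSpin (star V) = star (toSpin V) := by
  rw [star_eq_conjTranspose, star_eq_conjTranspose, toSpin_conjTranspose]

/-- `toSpin` of a real diagonal matrix is the relabelled diagonal matrix. [folklore] -/
private theorem toSpin_diagonal (u : Finset (Orb Λ₁) → ℝ) :
    toSpin (diagonal fun k => ((u k : ℝ) : ℂ)) =
      diagonal fun k : TensorIndex Λ₁ 4 => ((u (config k) : ℝ) : ℂ) := by
  rw [toSpin_eq_submatrix, submatrix_diagonal_equiv]; rfl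

/-- `toSpin (V diag(u) V⋆) = (toSpin V) diag(u ∘ config) (toSpin V)⋆` (the Jordan–Wigner isomorphism is a unital
`⋆`-algebra map). [cite: EsslerEtAl2005, §12.3.4 eqs. (12.196)–(12.197)] -/
theorem toSpin_conj_diagonal (V : Matrix (Finset (Orb Λ₁)) (Finset (Orb Λ₁)) ℂ) (u : Finset (Orb Λ₁) → ℝ) :
    toSpin (V * diagonal (fun k => ((u k : ℝ) : ℂ)) * star V) =
      toSpin V * diagonal (fun k : TensorIndex Λ₁ 4 => ((u (config k) : ℝ) : ℂ)) * star (toSpin V) := by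
  rw [map_mul, map_mul, toSpin_diagonal, toSpin_star]

/-- `toSpin` maps unitaries to unitaries (unital `⋆`-algebra map). [cite: EsslerEtAl2005, §12.3.4 eqs. (12.196)–(12.197)] -/
theorem toSpin_mem_unitaryGroup {V : Matrix (Finset (Orb Λ₁)) (Finset (Orb Λ₁)) ℂ}
    (hV : V ∈ Matrix.unitaryGroup (Finset (Orb Λ₁)) ℂ) :
    toSpin V ∈ Matrix.unitaryGroup (TensorIndex Λ₁ 4) ℂ := by
  rw [Matrix.mem_unitaryGroup_iff, ← toSpin_star, ← map_mul, Matrix.mem_unitaryGroup_iff.1 hV, map_one]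

/-- `toSpin` commutes with the Hadamard product (it is an entrywise relabelling). [folklore] -/
private theorem toSpin_hadamard (M N : Matrix (Finset (Orb Λ₁)) (Finset (Orb Λ₁)) ℂ) :
    toSpin (M ⊙ N) = toSpin M ⊙ toSpin N := by
  ext k k'; simp [hadamard_apply]

/-- `toSpin` of the Loewner matrix at `μ` is the Loewner matrix at `μ ∘ config`.
[cite: Petz2008, Example 11.7 eq. (11.13)] -/
private theorem toSpin_logLoewnerMatrix (μ : Finset (Orb Λ₁) → ℝ) :
    toSpin (logLoewnerMatrix μ) = logLoewnerMatrix fun k : TensorIndex Λ₁ 4 => μ (config k) := by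
  ext k k'; simp

/-- **`toSpin` transports the derivative map of `log`**: `toSpin (dlog_{V,μ}[E]) = dlog_{toSpin V, μ∘config}[toSpin E]`.
[cite: Petz2008, Example 11.7 eq. (11.12)] -/
theorem toSpin_logFrechet (V : Matrix (Finset (Orb Λ₁)) (Finset (Orb Λ₁)) ℂ) (μ : Finset (Orb Λ₁) → ℝ)
    (E : Matrix (Finset (Orb Λ₁)) (Finset (Orb Λ₁)) ℂ) :
    toSpin (logFrechet V μ E) = logFrechet (toSpin V) (fun k : TensorIndex Λ₁ 4 => μ (config k)) (toSpin E) := by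
  unfold logFrechet
  rw [map_mul, map_mul, toSpin_hadamard, toSpin_logLoewnerMatrix, map_mul, map_mul, toSpin_star]

end Transport

/-! ### §2. The certificate theorem, abstract initial segment -/

section Split

open JordanWigner

variable {A Λ₁ Λ₂ : Type} [LinearOrder A] [Fintype A] [LinearOrder Λ₁] [Fintype Λ₁] [LinearOrder Λ₂]
  [Fintype Λ₂]

/-- **Lieb-constant conditional-entropy certificate along an initial segment (abstract form).** Let
`ι : Λ₁ ↪o Λ₂` be an initial segment of the site order, split as `ε : Λ₂ ≃ A ⊕ Λ₁` with
`ι = inr ≫ ε⁻¹`; let `G` (on `Λ₂`) be Hermitian, `G_W = V diag(u) V⋆` (on `Λ₁`, `V` unitary, `u` real),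
`Z⁺ − tr_ι e^{−G} ⪰ 0` and `e^c·1 − dlog_{V, e^{−u}}[Z⁺] ⪰ 0`. Then every density matrix `σ` on the
Fock space over `Λ₂` satisfies `S(σ) − S(tr_ι σ) ≤ Re tr(σ G) − Re tr(tr_ι σ · G_W) + c`.
[cite: Lieb1973ConvexTrace, Theorems 6–7] [cite: PoulinHastings2011, eqs. (4)–(8)] -/
theorem fermion_condEntropy_le_of_liebCertificate_of_split (ι : Λ₁ ↪o Λ₂) (hι : IsLowerSet (Set.range ι))
    (ε : Λ₂ ≃ A ⊕ Λ₁)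
    (hιε : ι.toEmbedding = (Function.Embedding.inr : Λ₁ ↪ A ⊕ Λ₁).trans ε.symm.toEmbedding)
    {σ G : Matrix (Finset (Orb Λ₂)) (Finset (Orb Λ₂)) ℂ}
    {GW Zp V : Matrix (Finset (Orb Λ₁)) (Finset (Orb Λ₁)) ℂ} {u : Finset (Orb Λ₁) → ℝ} {c : ℝ}
    (hσ : σ.PosSemidef) (htr : σ.trace = 1) (hG : G.IsHermitian)
    (hV : V ∈ Matrix.unitaryGroup (Finset (Orb Λ₁)) ℂ)
    (hGW : GW = V * diagonal (fun k => ((u k : ℝ) : ℂ)) * star V)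
    (hZ : (Zp - fermionPartialTrace ι.toEmbedding (cfc Real.exp (-G))).PosSemidef)
    (hcert : (((Real.exp c : ℝ) : ℂ) • (1 : Matrix (Finset (Orb Λ₁)) (Finset (Orb Λ₁)) ℂ) -
      logFrechet V (fun k => Real.exp (-u k)) Zp).PosSemidef) :
    vonNeumannEntropy σ - vonNeumannEntropy (fermionPartialTrace ι.toEmbedding σ) ≤
      (σ * G).trace.re - (fermionPartialTrace ι.toEmbedding σ * GW).trace.re + c := by
  set Φ := splitProdEquiv ε with hΦ
  -- the transported data
  have hρ' : (σ.submatrix Φ Φ).PosSemidef := hσ.submatrix Φ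
  have htr' : (σ.submatrix Φ Φ).trace = 1 := by rw [trace_submatrix_equiv_equiv, htr]
  have hG' : (G.submatrix Φ Φ).IsHermitian := hG.submatrix Φ
  have hV' : toSpin V ∈ Matrix.unitaryGroup (TensorIndex Λ₁ 4) ℂ := toSpin_mem_unitaryGroup hV
  have hGW' : toSpin GW = toSpin V * diagonal (fun k : TensorIndex Λ₁ 4 => ((u (config k) : ℝ) : ℂ)) *
      star (toSpin V) := by rw [hGW, toSpin_conj_diagonal]
  have hT4 : traceLeft (σ.submatrix Φ Φ) = toSpin (fermionPartialTrace ι.toEmbedding σ) :=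
    traceLeft_submatrix_splitProdEquiv ι hι ε hιε σ
  -- `Z⁺ ≥ Tr_A e^{−G'}`
  have hZ' : (toSpin Zp - traceLeft (cfc Real.exp (-(G.submatrix Φ Φ)))).PosSemidef := by
    have h1 : cfc Real.exp (-(G.submatrix Φ Φ)) = (cfc Real.exp (-G)).submatrix Φ Φ := by
      have e : -(G.submatrix Φ Φ) = (-G).submatrix Φ Φ := by ext k k'; rfl
      rw [e]; exact cfc_submatrix_equiv hG.neg Φ _
    have h2 : traceLeft ((cfc Real.exp (-G)).submatrix Φ Φ) =
        toSpin (fermionPartialTrace ι.toEmbedding (cfc Real.exp (-G))) :=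
      traceLeft_submatrix_splitProdEquiv ι hι ε hιε _
    rw [h1, h2, ← map_sub]
    exact (posSemidef_toSpin_iff _).2 hZ
  -- the transported Lieb certificate
  have hcert' : (((Real.exp c : ℝ) : ℂ) • (1 : Matrix (TensorIndex Λ₁ 4) (TensorIndex Λ₁ 4) ℂ) -
      logFrechet (toSpin V) (fun k : TensorIndex Λ₁ 4 => Real.exp (-u (config k))) (toSpin Zp)).PosSemidef := by
    have h1 : logFrechet (toSpin V) (fun k : TensorIndex Λ₁ 4 => Real.exp (-u (config k))) (toSpin Zp) =
        toSpin (logFrechet V (fun k => Real.exp (-u k)) Zp) := by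
      rw [toSpin_logFrechet]
    have h2 : (((Real.exp c : ℝ) : ℂ) • (1 : Matrix (TensorIndex Λ₁ 4) (TensorIndex Λ₁ 4) ℂ)) =
        toSpin (((Real.exp c : ℝ) : ℂ) • (1 : Matrix (Finset (Orb Λ₁)) (Finset (Orb Λ₁)) ℂ)) := by
      rw [map_smul, map_one]
    rw [h1, h2, ← map_sub]
    exact (posSemidef_toSpin_iff _).2 hcert
  have key := condEntropy_le_of_liebCertificate hρ' htr' hG' hV' hGW' hZ' hcert'
  -- read back
  have e1 : vonNeumannEntropy (σ.submatrix Φ Φ) = vonNeumannEntropy σ := vonNeumannEntropy_submatrix_equiv hσ.1 Φ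
  have e2 : vonNeumannEntropy (traceLeft (σ.submatrix Φ Φ)) =
      vonNeumannEntropy (fermionPartialTrace ι.toEmbedding σ) := by
    rw [hT4]
    exact vonNeumannEntropy_toSpin (isHermitian_fermionPartialTrace ι.toEmbedding hσ.1)
  have e3 : (σ.submatrix Φ Φ * G.submatrix Φ Φ).trace = (σ * G).trace := by
    rw [Matrix.submatrix_mul_equiv, trace_submatrix_equiv_equiv]
  have e4 : (traceLeft (σ.submatrix Φ Φ) * toSpin GW).trace = (fermionPartialTrace ι.toEmbedding σ * GW).trace := by
    rw [hT4, ← map_mul, trace_toSpin]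
  rw [e1, e2, e3, e4] at key
  exact key

end Split

/-! ### §3. Windows of `ℤ^d`: the shield `Λ ∖ a` below the largest site `a` -/

section Window

variable {d : ℕ}

/-- Through the split `Λ ≃ {a} ⊔ (Λ ∖ a)`, the shield is the second summand. [folklore] -/
private theorem eraseInclO_eq_inr_trans' {Λ : Finset (Site d)} {a : Site d} (ha : a ∈ Λ) :
    (eraseInclO Λ a).toEmbedding =
      (Function.Embedding.inr : PolySite (Λ.erase a) ↪ PolySite ({a} : Finset (Site d)) ⊕ PolySite (Λ.erase a)).trans
        (windowSplitEquiv ha).symm.toEmbedding :=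
  DFunLike.ext _ _ fun _ => rfl

/-- **Lieb-constant conditional-entropy certificate for a lattice-fermion window.** Let `a` be the
lexicographically largest site of the window `Λ`, `B = Λ ∖ a`, `G ∈ 𝔄_Λ` Hermitian, `G_W = V diag(u) V⋆ ∈ 𝔄_B`
(`V` unitary, `u` real), `Z⁺ ∈ 𝔄_B` with `Z⁺ − tr_{B⊆Λ} e^{−G} ⪰ 0`, and `c` real with the certificate
`e^c·1 − dlog_{V, e^{−u}}[Z⁺] ⪰ 0` (`dlog = logFrechet`, Loewner matrix `L_ij = (u_j − u_i)/(e^{−u_i} − e^{−u_j})`,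
`L_ii = e^{u_i}`). Then for every density matrix `σ ∈ 𝔄_Λ`:
`S(σ) − S(σ_B) ≤ Re tr(σ G) − Re tr(σ_B G_W) + c`.
[cite: Lieb1973ConvexTrace, Theorems 6–7] [cite: PoulinHastings2011, eqs. (4)–(8)] -/
theorem fermion_condEntropy_le_of_liebCertificate {Λ : Finset (Site d)} {a : Site d} (ha : a ∈ Λ)
    (hmax : ∀ y ∈ Λ, toLex y ≤ toLex a)
    {σ G : FermionOp Λ} {GW Zp V : FermionOp (Λ.erase a)} {u : Finset (Orb (PolySite (Λ.erase a))) → ℝ}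
    {c : ℝ} (hσ : σ.PosSemidef) (htr : σ.trace = 1) (hG : G.IsHermitian)
    (hV : V ∈ Matrix.unitaryGroup (Finset (Orb (PolySite (Λ.erase a)))) ℂ)
    (hGW : GW = V * diagonal (fun k => ((u k : ℝ) : ℂ)) * star V)
    (hZ : (Zp - fermionPartialTrace (PolySite.incl (Finset.erase_subset a Λ)) (cfc Real.exp (-G))).PosSemidef)
    (hcert : (((Real.exp c : ℝ) : ℂ) • (1 : FermionOp (Λ.erase a)) -
      logFrechet V (fun k => Real.exp (-u k)) Zp).PosSemidef) :
    vonNeumannEntropy σ - vonNeumannEntropy (fermionPartialTrace (PolySite.incl (Finset.erase_subset a Λ)) σ) ≤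
      (σ * G).trace.re - (fermionPartialTrace (PolySite.incl (Finset.erase_subset a Λ)) σ * GW).trace.re + c := by
  rw [← eraseInclO_toEmbedding] at hZ ⊢
  exact fermion_condEntropy_le_of_liebCertificate_of_split (eraseInclO Λ a) (isLowerSet_range_eraseInclO hmax)
    (windowSplitEquiv ha) (eraseInclO_eq_inr_trans' ha) hσ htr hG hV hGW hZ hcert

/-- **The Lieb certificate in the conditional free-energy shape.** Same data; with `H := G − Γ G_W ∈ 𝔄_Λ`
(`Γ = fermionEmbed (Λ∖a ⊆ Λ)`): for every density matrix `σ ∈ 𝔄_Λ`, `S(σ) − S(σ_B) − Re tr(σ H) ≤ c` — the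
hypothesis shape of the conditional-entropy rows of the thermal certificates (`TorusSectorGibbsCondEntropyRow.lean`),
now with the LIEB constant instead of a Löwner dual variable. [cite: Lieb1973ConvexTrace, Theorems 6–7]
[cite: PoulinHastings2011, eqs. (4)–(8)] -/
theorem fermion_condFreeEnergy_le_of_liebCertificate {Λ : Finset (Site d)} {a : Site d} (ha : a ∈ Λ)
    (hmax : ∀ y ∈ Λ, toLex y ≤ toLex a)
    {σ G : FermionOp Λ} {GW Zp V : FermionOp (Λ.erase a)} {u : Finset (Orb (PolySite (Λ.erase a))) → ℝ}
    {c : ℝ} (hσ : σ.PosSemidef) (htr : σ.trace = 1) (hG : G.IsHermitian)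
    (hV : V ∈ Matrix.unitaryGroup (Finset (Orb (PolySite (Λ.erase a)))) ℂ)
    (hGW : GW = V * diagonal (fun k => ((u k : ℝ) : ℂ)) * star V)
    (hZ : (Zp - fermionPartialTrace (PolySite.incl (Finset.erase_subset a Λ)) (cfc Real.exp (-G))).PosSemidef)
    (hcert : (((Real.exp c : ℝ) : ℂ) • (1 : FermionOp (Λ.erase a)) -
      logFrechet V (fun k => Real.exp (-u k)) Zp).PosSemidef) :
    vonNeumannEntropy σ - vonNeumannEntropy (fermionPartialTrace (PolySite.incl (Finset.erase_subset a Λ)) σ) -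
      (σ * (G - fermionEmbed (PolySite.incl (Finset.erase_subset a Λ)) GW)).trace.re ≤ c := by
  have h := fermion_condEntropy_le_of_liebCertificate ha hmax hσ htr hG hV hGW hZ hcert
  have htrGW : (fermionPartialTrace (PolySite.incl (Finset.erase_subset a Λ)) σ * GW).trace =
      (σ * fermionEmbed (PolySite.incl (Finset.erase_subset a Λ)) GW).trace := by
    rw [Matrix.trace_mul_comm, trace_mul_fermionPartialTrace, Matrix.trace_mul_comm]
  rw [Matrix.mul_sub, Matrix.trace_sub, Complex.sub_re, ← htrGW]
  linarith

end Window

end Literature.MathematicalPhysics.QuantumLattice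

end
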